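import Summits.QuantumFields.YangMills.Theses.BackwardLiouvilleRigidity
import Literature.MathematicalPhysics.QuantumFieldTheory.Balaban1983to89.T3MinimiserStabilityReduction

/-!
# BC3 skeleton for the support item `FlatRatioTermination` (rev 4, stmt-QuantumFields-22542) of
route-QuantumFields-BackwardLiouvilleRigidity (line «backward-liouville-rigidity», ym-r3-idea-1 g10)

Five registered stubs (g10 re-cut of the geometric step: `stub_innerWindowGaugeSmall` + `stub_gaugeSmallChains` + `stub_thresholds` ⊢ `innerWindowChains`) and a kernel-checked composition concluding
`Summit.QuantumFields.YangMills.Theses.BackwardLiouvilleRigidity.FlatRatioTermination` BY NAME (pT := pW, γ₁ := 1):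

* `stub_innerWindowChains` (GEOMETRIC, M/L — the bet of the termination; SU(2)-specific): INNER-WINDOW CHAIN LEMMA. For p₀ ≥ pW and
  every family F, γ ∈ (0,1], b₀ > 0, from some height jW on, every configuration U of the INNER window (all plaquettes within
  θBal F.L γ (√b₀) (p₀/2) j = g_j·√p(g_j), `T3InteriorExcision.θBal_mul`) is joined to the trivial configuration by a chain of
  ≤ #PBond_j² ONE-BOND MOVES inside the window S_j = {PlaqSmall (θBal F.L γ b₀ p₀ j)} (= g_j·p(g_j); room factor √p(g_j) → ∞).
  Why it might fail: the open window is NOT one-bond connected with polynomial diameter in general — near a critical level of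
  U ↦ max_p dist1(U_p) (embedded constant abelian flux is a local minimum modulo flat directions) admissible moves have size
  O(√slack); the lemma therefore starts strictly inside (factor 1/√p) and bets that flux unwinds through non-abelian directions with room
  to spare (true for embedded abelian flux: move one quantum into a box linearly, contract the loop in SU(2) = S³, repeat; FALSE for gauge
  group U(1): magnetic flux sectors).  A room requirement growing like N^a would kill the termination (kill criterion on the card).
* `stub_windowTV` (REAL ANALYSIS / finite-dimensional measure theory, M): SINGLE-HEIGHT TOTAL-VARIATION BOUND, uniform in the lattice:
  for every ε > 0 there is δ₀ > 0 such that at one height, positivity of ρ, ρ' on the window, μ = Haar·ρ, μ' = Haar·ρ', chains of length ≤ D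
  from the inner window to 1 inside the window, one-bond oscillation ≤ τ of log ρ − log ρ' on the window with τ·D ≤ δ₀, and inner tails ≤ ηr ≤ δ₀
  for both laws give |μ(A) − μ'(A)| ≤ ε for every measurable A (proof: |r(U) − r(1)| ≤ τD on the inner window G; m = μ(G), m' = μ'(G) ∈ [1−ηr, 1];
  TV ≤ e^(2τD)/(1−ηr) − 1 + 2ηr).
* `stub_pushToZero` (MEASURE THEORY, S/M): two CONSISTENT trajectories whose height-j laws are ε-close in total variation for every ε at some
  height have equal height-0 loop integrals (μ_0 = (descend∘⋯∘descend)_* μ_j by consistency, `T3NestedUnitLaws.measurable_descend`,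
  |Π loopAt| ≤ 1).
No summit, rung or crux is proved here; `FlatRatioTermination` is a SUPPORT item.
-/

namespace Summit.QuantumFields.YangMills.Cruxes.FlatRatioTermination.BackwardLiouville

open scoped Topology
open Filter MeasureTheory

/-- stub (GEOMETRIC/TOPOLOGICAL, M/L — the hardest stub): INNER WINDOW ⇒ SMALL GLOBAL GAUGE. For p₀ ≥ pW, every family F,
γ ∈ (0,1], b₀ > 0, from some height on, every configuration with all plaquettes within θ_in = θBal F.L γ (√b₀) (p₀/2) j = θ_j/√p(g_j)
admits a gauge in which EVERY bond is within √θ_j/16 of the identity (θ_j = θBal F.L γ b₀ p₀ j).  Plan (card §Plan): box-axial gauges on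
boxes of side R ≍ θ_in^(-1/2) (bond bound (d−1)·R·θ_in, `B15Extension193`-type tree-gauge estimate, NO smallness condition) + raster-order
gluing of the box gauges by SU(2)-valued corrections s_α extended from box boundaries with Lipschitz constant O(1/R) (discrete cone extension:
the boundary data sheet misses a ball of radius O(1) in S³ = SU(2); π₀ = π₁ = π₂(S³) = 0), torus wrap-around absorbed by spreading holonomies
over N/R ≫ 1 boxes; resulting bonds O(θ_in^(1/2)) = θ_j^(1/2)·p(g_j)^(-1/4) ≪ θ_j^(1/2)/16. -/
theorem stub_innerWindowGaugeSmall : open MeasureTheory Filter Topology Literature.MathematicalPhysics.QuantumFieldTheory.Balaban1983to89 T3ContinuumYM3Torus T3NestedUnitLaws T3UnitLawDensityEML T4Continuum BalabanUVClass T3UnitScaleTilt in ∃ pW : ℝ, ∀ (p₀ : ℝ), pW ≤ p₀ → ∀ (F : T3Family) (γ b₀ : ℝ), 0 < γ → γ ≤ 1 → 0 < b₀ → ∃ jW : ℕ, ∀ j : ℕ, jW ≤ j → ∀ U : GaugeField (F.P j) 0 ↥(Matrix.specialUnitaryGroup (Fin 2) ℂ), PlaqSmall (θBal F.L γ (Real.sqrt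 b₀) (p₀ / 2) j) U → (∃ u : GaugeTransf (F.P j) 0 ↥(Matrix.specialUnitaryGroup (Fin 2) ℂ), ∀ b : PBond (F.P j) 0, dist1 (GaugeField.gaugeAct u U b) < Real.sqrt (θBal F.L γ b₀ p₀ j) / 16) := by
  sorry

/-- stub (ALGEBRA + BOOKKEEPING, M): SMALL GAUGE ⇒ ONE-BOND CHAIN INSIDE THE WINDOW (pure lattice lemma, explicit constants).  If all plaquettes
of U are within δ and some gauge transform of U has all bonds within η (operator norm), with δ + 32η² < θ and the move budget
1/η² + 2/η + 4 ≤ #PBond, then U is joined to the trivial configuration by ≤ #PBond² one-bond moves through configurations with all plaquettes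
within θ.  Plan: (1) apply the gauge transformation site by site in n = ⌈2π/(θ−δ)⌉ geodesic increments (plaquettes stay within δ + π/n,
`dist1_conj`, `dist1_mul_le`); (2) shrink all bond logarithms linearly, bonds one at a time in K = ⌈1.05/η⌉ + 1 rounds (second-order
expansion of a product of four exponentials with ‖a_i‖ ≤ 1.05η: ‖U(∂p)(t) − 1‖ ≤ δ + 27.4η² + 4.2η/K ≤ δ + 32η²); moves ≤ #PBond·(0.4/η² +
1.05/η + 4). -/
theorem stub_gaugeSmallChains : open MeasureTheory Filter Topology Literature.MathematicalPhysics.QuantumFieldTheory.Balaban1983to89 T3ContinuumYM3Torus T3NestedUnitLaws T3UnitLawDensityEML T4Continuum BalabanUVClass T3UnitScaleTilt in ∀ (F : T3Family) (j : ℕ) (θ δ η : ℝ), 0 < η → η ≤ 1 / 4 → 0 ≤ δ → δ + 32 * η ^ 2 < θ → 1 / η ^ 2 + 2 / η + 4 ≤ (Fintype.card (PBond (F.P j) 0) : ℝ) → ∀ U : GaugeField (F.P j) 0 ↥(Matrix.specialUnitaryGroup (Fin 2) ℂ), PlaqSmall δ U → (∃ u : GaugeTransf (F.P j) 0 ↥(Matrix.specialUnitaryGroup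 (Fin 2) ℂ), ∀ b : PBond (F.P j) 0, dist1 (GaugeField.gaugeAct u U b) < η) → ∃ (n : ℕ) (W : ℕ → GaugeField (F.P j) 0 ↥(Matrix.specialUnitaryGroup (Fin 2) ℂ)), n ≤ Fintype.card (PBond (F.P j) 0) ^ 2 ∧ (∀ e, W 0 e = 1) ∧ W n = U ∧ (∀ i, i ≤ n → PlaqSmall (θ) (W i)) ∧ (∀ i, i < n → ∃ b : PBond (F.P j) 0, ∀ e, e ≠ b → W i e = W (i + 1) e) := by
  sorry

/-- stub (ASYMPTOTICS OF BAŁABAN'S THRESHOLDS, S/M): for p₀ ≥ pW (any pW > 0 works) and j large, with θ_j = g_j·p(g_j), g_j = √(γL^(-j)) → 0,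
θ_in = θ_j/√p(g_j) (`T3InteriorExcision.θBal_mul`, `B10.pFun`) and #PBond_j = 3·(sites per direction)³ → ∞ geometrically: η_j = √θ_j/16 ∈ (0, 1/4],
θ_in + 32η_j² = θ_in + θ_j/8 < θ_j, and 1/η_j² + 2/η_j + 4 ≤ #PBond_j. -/
theorem stub_thresholds : open MeasureTheory Filter Topology Literature.MathematicalPhysics.QuantumFieldTheory.Balaban1983to89 T3ContinuumYM3Torus T3NestedUnitLaws T3UnitLawDensityEML T4Continuum BalabanUVClass T3UnitScaleTilt in ∃ pW : ℝ, ∀ (p₀ : ℝ), pW ≤ p₀ → ∀ (F : T3Family) (γ b₀ : ℝ), 0 < γ → γ ≤ 1 → 0 < b₀ → ∃ jW : ℕ, ∀ j : ℕ, jW ≤ j → 0 < Real.sqrt (θBal F.L γ b₀ p₀ j) / 16 ∧ Real.sqrt (θBal F.L γ b₀ p₀ j) / 16 ≤ 1 / 4 ∧ θBal F.L γ (Real.sqrt b₀) (p₀ / 2) j + 32 * (Real.sqrt (θBal F.L γ b₀ p₀ j) / 16) ^ 2 < θBal F.L γ b₀ p₀ j ∧ 1 / (Real.sqrt (θBal F.L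 γ b₀ p₀ j) / 16) ^ 2 + 2 / (Real.sqrt (θBal F.L γ b₀ p₀ j) / 16) + 4 ≤ (Fintype.card (PBond (F.P j) 0) : ℝ) := by
  sorry

/-- INNER-WINDOW CHAIN LEMMA (the rev-4 registered stub `stub_innerWindowChains`, now DERIVED from the three stubs above; kernel-checked). -/
theorem innerWindowChains : open MeasureTheory Filter Topology Literature.MathematicalPhysics.QuantumFieldTheory.Balaban1983to89 T3ContinuumYM3Torus T3NestedUnitLaws T3UnitLawDensityEML T4Continuum BalabanUVClass T3UnitScaleTilt in ∃ pW : ℝ, ∀ (p₀ : ℝ), pW ≤ p₀ → ∀ (F : T3Family) (γ b₀ : ℝ), 0 < γ → γ ≤ 1 → 0 < b₀ → ∃ jW : ℕ, ∀ j : ℕ, jW ≤ j → (∀ U : GaugeField (F.P j) 0 ↥(Matrix.specialUnitaryGroup (Fin 2) ℂ), PlaqSmall (θBal F.L γ (Real.sqrt b₀) (p₀ / 2) j) U → ∃ (n : ℕ) (W : ℕ → GaugeField (F.P j) 0 ↥(Matrix.specialUnitaryGroup (Fin 2) ℂ)), n ≤ Fintype.card (PBond (F.P j) 0) ^ 2 ∧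 (∀ e, W 0 e = 1) ∧ W n = U ∧ (∀ i, i ≤ n → PlaqSmall (θBal F.L γ b₀ p₀ j) (W i)) ∧ (∀ i, i < n → ∃ b : PBond (F.P j) 0, ∀ e, e ≠ b → W i e = W (i + 1) e)) := by
  classical
  obtain ⟨pW₁, h₁⟩ := stub_innerWindowGaugeSmall
  obtain ⟨pW₂, h₂⟩ := stub_thresholds
  refine ⟨max pW₁ pW₂, fun p₀ hp F γ b₀ hγ hγ1 hb₀ => ?_⟩
  obtain ⟨jW₁, hj₁⟩ := h₁ p₀ ((le_max_left _ _).trans hp) F γ b₀ hγ hγ1 hb₀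
  obtain ⟨jW₂, hj₂⟩ := h₂ p₀ ((le_max_right _ _).trans hp) F γ b₀ hγ hγ1 hb₀
  refine ⟨max jW₁ jW₂, fun j hj U hU => ?_⟩
  obtain ⟨hη, hη4, hδ, hbud⟩ := hj₂ j ((le_max_right _ _).trans hj)
  have hθin : 0 ≤ Literature.MathematicalPhysics.QuantumFieldTheory.Balaban1983to89.T3UnitScaleTilt.θBal F.L γ (Real.sqrt b₀) (p₀ / 2) j :=
    (Literature.MathematicalPhysics.QuantumFieldTheory.Balaban1983to89.T3MinimiserStabilityReduction.θBal_pos F.hL.2.le hγ hγ1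
      (Real.sqrt_pos.mpr hb₀) _ _).le
  exact stub_gaugeSmallChains F j _ _ _ hη hη4 hθin hδ hbud U hU (hj₁ j ((le_max_left _ _).trans hj) U hU)

/-- stub (M): SINGLE-HEIGHT TV BOUND from chains + one-bond oscillation + inner tails (ε–δ form, uniform in the lattice). -/
theorem stub_windowTV : open MeasureTheory Filter Topology Literature.MathematicalPhysics.QuantumFieldTheory.Balaban1983to89 T3ContinuumYM3Torus T3NestedUnitLaws T3UnitLawDensityEML T4Continuum BalabanUVClass T3UnitScaleTilt in ∀ ε : ℝ, 0 < ε → ∃ δ₀ : ℝ, 0 < δ₀ ∧ ∀ (F : T3Family) (j D : ℕ) (θin θ τ ηr : ℝ), 0 < θin → 0 ≤ τ → τ * (D : ℝ) ≤ δ₀ → 0 ≤ ηr → ηr ≤ δ₀ → ∀ (μ μ' : MeasureTheory.Measure (GaugeField (F.P j) 0 ↥(Matrix.specialUnitaryGroup (Fin 2) ℂ))) (ρ ρ' : GaugeField (F.P j) 0 ↥(Matrix.specialUnitaryGroup (Fin 2) ℂ) → ℝ), IsProbabilityMeasure μ → IsProbabilityMeasure μ' → (∀ U, PlaqSmall θ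 U → 0 < ρ U ∧ 0 < ρ' U) → μ = (fieldMeasure _ _ _).withDensity (fun U => ENNReal.ofReal (ρ U)) → μ' = (fieldMeasure _ _ _).withDensity (fun U => ENNReal.ofReal (ρ' U)) → (∀ U : GaugeField (F.P j) 0 ↥(Matrix.specialUnitaryGroup (Fin 2) ℂ), PlaqSmall (θin) U → ∃ (n : ℕ) (W : ℕ → GaugeField (F.P j) 0 ↥(Matrix.specialUnitaryGroup (Fin 2) ℂ)), n ≤ D ∧ (∀ e, W 0 e = 1) ∧ W n = U ∧ (∀ i, i ≤ n → PlaqSmall (θ) (W i)) ∧ (∀ i, i < n → ∃ b : PBond (F.P j) 0, ∀ e, e ≠ b → W i e = W (i + 1) e)) → (∀ (b : PBond (F.P j) 0) U V, PlaqSmall θ U → PlaqSmall θ V → (∀ e, e ≠ b → U e = V e) → |(Real.log (ρ U) - Real.log (ρ' U)) - (Real.log (ρ V) - Real.log (ρ' V))| ≤ τ) → μ {U | ¬ PlaqSmall θin U} ≤ ENNReal.ofReal ηr → μ' {U | ¬ PlaqSmall θin U} ≤ ENNReal.ofReal ηr → ∀ A : Set (GaugeField (F.P j) 0 ↥(Matrix.specialUnitaryGroup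 (Fin 2) ℂ)), MeasurableSet A → |μ.real A - μ'.real A| ≤ ε := by
  sorry

/-- stub (S/M): consistency pushes total-variation closeness at some height down to equal height-0 loop integrals. -/
theorem stub_pushToZero : open MeasureTheory Filter Topology Literature.MathematicalPhysics.QuantumFieldTheory.Balaban1983to89 T3ContinuumYM3Torus T3NestedUnitLaws T3UnitLawDensityEML T4Continuum BalabanUVClass T3UnitScaleTilt in ∀ (F : T3Family) (μ μ' : ((j : ℕ) → MeasureTheory.Measure (GaugeField (F.P j) 0 ↥(Matrix.specialUnitaryGroup (Fin 2) ℂ)))), (∀ j : ℕ, IsProbabilityMeasure (μ j) ∧ μ j = Measure.map (descend F ℰp j) (μ (j + 1))) → (∀ j : ℕ, IsProbabilityMeasure (μ' j) ∧ μ' j = Measure.map (descend F ℰp j) (μ' (j + 1))) → (∀ ε : ℝ, 0 < ε → ∃ j : ℕ, ∀ A : Set (GaugeField (F.P j) 0 ↥(Matrix.specialUnitaryGroup (Fin 2) ℂ)), MeasurableSet A → |(μ j).real A - (μ' j).real A| ≤ ε) → ∀ os : List (ULoop3 F), (∫ u, (os.map fun C => loopAt u (C.1.atLevel 0)).prod ∂(μ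 0)) = (∫ u, (os.map fun C => loopAt u (C.1.atLevel 0)).prod ∂(μ' 0)) := by
  sorry

/-- COMPOSITION (kernel-checked, no sorry outside the stubs). -/
theorem flatRatioTermination_of_stubs : Summit.QuantumFields.YangMills.Theses.BackwardLiouvilleRigidity.FlatRatioTermination := by
  classical
  obtain ⟨pW, hW⟩ := innerWindowChains
  refine ⟨pW, 1, one_pos, ?_⟩
  intro F γ hγ hγ1 b₀ p₀ κ j₀ prm ω η hp hb₀ hκ hpos hη μ μ' ρ ρ' hc hc' hB hIn hosc
  obtain ⟨jW, hjW⟩ := hW p₀ hp F γ b₀ hγ hγ1 hb₀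
  obtain ⟨j₁, hj₀₁, τ, hτ, hlim⟩ := hosc
  refine stub_pushToZero F μ μ' hc hc' ?_
  intro ε hε
  obtain ⟨δ₀, hδ₀, hT⟩ := stub_windowTV ε hε
  have hη0 : Tendsto η atTop (𝓝 0) := hη.tendsto_atTop_zero
  obtain ⟨N₁, hN₁⟩ := eventually_atTop.mp (hlim.eventually (gt_mem_nhds hδ₀))
  obtain ⟨N₂, hN₂⟩ := eventually_atTop.mp (hη0.eventually (gt_mem_nhds hδ₀))
  set j : ℕ := max (max j₀ j₁) (max jW (max N₁ N₂)) with hjdef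
  have hj₀ : j₀ ≤ j := (le_max_left _ _).trans (le_max_left _ _)
  have hj₁ : j₁ ≤ j := (le_max_right _ _).trans (le_max_left _ _)
  have hjWj : jW ≤ j := (le_max_left _ _).trans (le_max_right _ _)
  have hN₁j : N₁ ≤ j := ((le_max_left _ _).trans (le_max_right _ _)).trans (le_max_right _ _)
  have hN₂j : N₂ ≤ j := ((le_max_right _ _).trans (le_max_right _ _)).trans (le_max_right _ _)
  refine ⟨j, ?_⟩
  obtain ⟨hposj, hd, hd', -, -, -, -, -, -⟩ := hB j hj₀
  have hθin : 0 < Literature.MathematicalPhysics.QuantumFieldTheory.Balaban1983to89.T3UnitScaleTilt.θBal F.L γ (Real.sqrt b₀) (p₀ / 2) j :=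
    Literature.MathematicalPhysics.QuantumFieldTheory.Balaban1983to89.T3MinimiserStabilityReduction.θBal_pos F.hL.2.le hγ hγ1 (Real.sqrt_pos.mpr hb₀) _ _
  have hτD : max (τ j) 0 * ((Fintype.card (Literature.MathematicalPhysics.QuantumFieldTheory.Balaban1983to89.PBond (F.P j) 0) ^ 2 : ℕ) : ℝ) ≤ δ₀ := by
    have h1 := hN₁ j hN₁j
    rcases le_or_gt (τ j) 0 with hneg | hposτ
    · rw [max_eq_right hneg, zero_mul]; exact hδ₀.le
    · rw [max_eq_left hposτ.le]; push_cast; exact h1.le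
  refine hT F j _ _ _ (max (τ j) 0) (η j) hθin (le_max_right _ _) hτD (hpos j).2 (hN₂ j hN₂j).le (μ j) (μ' j) (ρ j) (ρ' j) (hc j).1 (hc' j).1 hposj hd hd' (hjW j hjWj) ?_ (hIn j hj₀).1 (hIn j hj₀).2
  intro b U V hU hV hUV
  exact (hτ j hj₁ b U V hU hV hUV).trans (le_max_left _ _)

end Summit.QuantumFields.YangMills.Cruxes.FlatRatioTermination.BackwardLiouville
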